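import Summits.BirchSwinnertonDyer.BirchSwinnertonDyer.Theorems.KolyvaginDepthDoorDepthTableRowsSecondSign7
import Summits.BirchSwinnertonDyer.BirchSwinnertonDyer.Theorems.KolyvaginDepthDoorDepthTableRowsSecondSign8
import Summits.BirchSwinnertonDyer.BirchSwinnertonDyer.Theorems.KolyvaginDepthDoorDepthTableRowsSecondSign9
import Summits.BirchSwinnertonDyer.BirchSwinnertonDyer.Theorems.KolyvaginDepthDoorDepthTableRowsSecondSign10
import HarnessLib

/-!
# Route `KolyvaginDepthDoor` — DEPTH-ZERO VANISHING ROWS ON THE SECOND SIGN, bit-free: the class of the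
# basic Heegner point `y_K` dies in `H¹(K, E[p])` for rank-one curves with a rank-two Heegner
# twist, part 2 (crux `KolyvaginDepthSupply`, stmt-BirchSwinnertonDyer-21765)

Helper file (`--supports stmt-BirchSwinnertonDyer-21765 --as helper`); it closes nothing and BSD is
not proved by it.

Companion of the second-sign rows `SecondSign.C<label>.depthRow_<p>_neg<|D|>_<ℓ>_secondSign` (files
`…DepthTableRowsSecondSign1–6`): there the bit `c_1(ℓ) ≠ 0` is the input. Here NO class is computed:
for each `(E, D, p)` of the second-sign table the kit's bit-free companion
`depthRowZeroTwist_vanishes_printKN_of_intModel_certificate` (g9's points-first vanishing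
`kolyvaginClass_eq_zero_of_rank_of_datum_kodairaNeron` on the twist disjunct `ν + 2 ≤ rank E^{(d_K)}(ℚ)`,
`ν = 0`) turns the kernel certificate `2 ≤ rank_ℤ E^{(D)}(ℚ)` (two rational points on the twist model)
into: for ANY frame `(Dt, β, ι)` and ANY Kolyvagin–Heegner datum `d` of conductor `1`,
`d.kolyvaginClass _ 1 = 0` — the class of `P(1) = Tr_{K[1]/K} y(1) = y_K` VANISHES in `H¹(K, E[p])`.
This is the mod-`p`, points-first shadow of what Gross–Zagier read off `L'(E/K, 1) = 0` (the Heegner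
point `y_K` is torsion when `E^{(D)}` has analytic rank `2`; for `E = 37a1`, `D = −139` this is the
classical example of a vanishing Heegner point) and of Kolyvagin's theorem in contrapositive
(`rank E(K) = 1 + 2 ≥ 2` forces `y_K` torsion) — obtained here from the tree's PROVED minimal-depth
descent with the ONE named input (γ) = `GrossLMS1991.prop37_2_frobeniusCongruence`. JLS-falsifiable
(`P(1) ∈ pE(K) + E(K)_tors`). CONDITIONAL on (γ); per-curve; BSD is not proved by it.

| curve | `p` | `d_K` | twist model | certified points on the twist |
|---|---|---|---|---|
| `83a1` = `[1,1,1,1,0]` | `5` | `-103` | `[0,-515,0,254616,-17483632]` | `(1339, -42436)`, `(256264/25, -126586588/125)` |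
| `83a1` = `[1,1,1,1,0]` | `7` | `-115` | `[0,-575,0,317400,-24334000]` | `(240580, -117861200)`, `(3220/9, -211600/27)` |
| `89a1` = `[1,1,1,-1,0]` | `5` | `-91` | `[0,-455,0,-66248,-12057136]` | `(1820, -66248)`, `(2022748/9, -2873904488/27)` |
| `101a1` = `[0,1,1,-1,-1]` | `5` | `-179` | `[0,-716,0,-512656,275296272]` | `(2864, -128164)`, `(44929/4, -9195767/8)` |
| `131a1` = `[0,-1,1,1,0]` | `5` | `-71` | `[0,284,0,80656,-5726576]` | `(1349, -55451)`, `(232312/729, -177342380/19683)` |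
| `131a1` = `[0,-1,1,1,0]` | `7` | `-155` | `[0,620,0,384400,-59582000]` | `(1860, -96100)`, `(206460/49, -101385500/343)` |

References: [Kolyvagin1991MathAnn] Thm. 2.3, Thm. 4; [GrossLMS1991] Prop. 3.7 (2), §4 (P_1 = y_K), §10;
[Kolyvagin1990] Thm. A; [SilvermanAEC2009] VII.6.1, VIII.6.7.
-/

set_option linter.dupNamespace false

noncomputable section

open scoped Classical NumberField

namespace Summit.BirchSwinnertonDyer.BirchSwinnertonDyer.Theorems.KolyvaginDepthDoor

open Literature.NumberTheory.EllipticCurves Literature.NumberTheory.EllipticCurves.ModularForms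
  WeierstrassCurve
open Summit.BirchSwinnertonDyer.BirchSwinnertonDyer.Rank2Observatory

namespace SecondSign

namespace C83a1

/-- **DEPTH-ZERO VANISHING ROW `83a1`, `(p, d_K) = (5, -103)` — NO bit.** For `E = 83a1` (rank one), ANY
imaginary quadratic `K` with `d_K = -103` (Heegner for `N_E`), any frame `(Dt, β, ι)` and ANY
Kolyvagin–Heegner datum `d` of conductor `1`, granted (γ) = `GrossLMS1991.prop37_2_frobeniusCongruence`:
`d.kolyvaginClass _ 1 = 0` in `H¹(K, E[5])` — the class of `y_K` vanishes mod `5`, because the twist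
`E^{(-103)}` has two independent rational points (`two_le_rank_twist_neg103`, kernel) and a non-zero
depth-`0` class would force `1 ≥ rank_ℤ E^{(d_K)}(ℚ)` (minimal-depth descent, proved in the tree);
side conditions from `…RowsSecondSign7`. CONDITIONAL on (γ); per-curve; BSD is not proved by it.
[cite: Kolyvagin1991MathAnn, Thm. 2.3 and Thm. 4] [cite: GrossLMS1991, Prop. 3.7 (2), §4 (P_1 = y_K), §10] -/
theorem depthRowZero_5_neg103_vanishes_secondSign
    (h372 : GrossLMS1991.prop37_2_frobeniusCongruence)
    (K : Type) [Field K] [NumberField K] (hK : IsImaginaryQuadratic K)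
    (hD : NumberField.discr K = -103) :
    haveI := isElliptic;
    haveI := isGloballyMinimal;
    haveI : NeZero (((⟨1, 1, 1, 1, 0⟩ : WeierstrassCurve ℤ).map (Int.castRingHom ℚ)).conductorNorm ℤ) := neZero_conductorNorm_of_isElliptic _;
    ∀ (Dt : ModularParametrizationData ((⟨1, 1, 1, 1, 0⟩ : WeierstrassCurve ℤ).map (Int.castRingHom ℚ)) (((⟨1, 1, 1, 1, 0⟩ : WeierstrassCurve ℤ).map (Int.castRingHom ℚ)).conductorNorm ℤ)) (β : ℤ) (ι : K →+* ℂ)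
      (d : KolyvaginHeegnerData Dt β ι 1),
    d.kolyvaginClass (p := 5) (by norm_num) 1 = 0 := by
  haveI := isElliptic
  haveI := isGloballyMinimal
  haveI : NeZero (((⟨1, 1, 1, 1, 0⟩ : WeierstrassCurve ℤ).map (Int.castRingHom ℚ)).conductorNorm ℤ) := neZero_conductorNorm_of_isElliptic _
  intro Dt β ι d
  haveI := Fact.mk (by norm_num : Nat.Prime 5)
  exact depthRowZeroTwist_vanishes_printKN_of_intModel_certificate intModel h372 not_hasCM 5
    (by norm_num) hasSurjectiveModNGaloisRep_pow_5 K hK hD (by norm_num) (by norm_num)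
    twistModel_neg103 two_le_rank_twist_neg103 heegner_neg103 (Δ₀ := -83) (by decide +kernel)
    (B := 11) (by decide +kernel) (by decide +kernel) (fun _ _ ↦ Or.inl (by norm_num)) Dt β ι d

/-- **DEPTH-ZERO VANISHING ROW `83a1`, `(p, d_K) = (7, -115)` — NO bit.** For `E = 83a1` (rank one), ANY
imaginary quadratic `K` with `d_K = -115` (Heegner for `N_E`), any frame `(Dt, β, ι)` and ANY
Kolyvagin–Heegner datum `d` of conductor `1`, granted (γ) = `GrossLMS1991.prop37_2_frobeniusCongruence`:
`d.kolyvaginClass _ 1 = 0` in `H¹(K, E[7])` — the class of `y_K` vanishes mod `7`, because the twist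
`E^{(-115)}` has two independent rational points (`two_le_rank_twist_neg115`, kernel) and a non-zero
depth-`0` class would force `1 ≥ rank_ℤ E^{(d_K)}(ℚ)` (minimal-depth descent, proved in the tree);
side conditions from `…RowsSecondSign7`. CONDITIONAL on (γ); per-curve; BSD is not proved by it.
[cite: Kolyvagin1991MathAnn, Thm. 2.3 and Thm. 4] [cite: GrossLMS1991, Prop. 3.7 (2), §4 (P_1 = y_K), §10] -/
theorem depthRowZero_7_neg115_vanishes_secondSign
    (h372 : GrossLMS1991.prop37_2_frobeniusCongruence)
    (K : Type) [Field K] [NumberField K] (hK : IsImaginaryQuadratic K)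
    (hD : NumberField.discr K = -115) :
    haveI := isElliptic;
    haveI := isGloballyMinimal;
    haveI : NeZero (((⟨1, 1, 1, 1, 0⟩ : WeierstrassCurve ℤ).map (Int.castRingHom ℚ)).conductorNorm ℤ) := neZero_conductorNorm_of_isElliptic _;
    ∀ (Dt : ModularParametrizationData ((⟨1, 1, 1, 1, 0⟩ : WeierstrassCurve ℤ).map (Int.castRingHom ℚ)) (((⟨1, 1, 1, 1, 0⟩ : WeierstrassCurve ℤ).map (Int.castRingHom ℚ)).conductorNorm ℤ)) (β : ℤ) (ι : K →+* ℂ)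
      (d : KolyvaginHeegnerData Dt β ι 1),
    d.kolyvaginClass (p := 7) (by norm_num) 1 = 0 := by
  haveI := isElliptic
  haveI := isGloballyMinimal
  haveI : NeZero (((⟨1, 1, 1, 1, 0⟩ : WeierstrassCurve ℤ).map (Int.castRingHom ℚ)).conductorNorm ℤ) := neZero_conductorNorm_of_isElliptic _
  intro Dt β ι d
  haveI := Fact.mk (by norm_num : Nat.Prime 7)
  exact depthRowZeroTwist_vanishes_printKN_of_intModel_certificate intModel h372 not_hasCM 7
    (by norm_num) hasSurjectiveModNGaloisRep_pow_7 K hK hD (by norm_num) (by norm_num)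
    twistModel_neg115 two_le_rank_twist_neg115 heegner_neg115 (Δ₀ := -83) (by decide +kernel)
    (B := 11) (by decide +kernel) (by decide +kernel) (fun _ _ ↦ Or.inl (by norm_num)) Dt β ι d

end C83a1

namespace C89a1

/-- **DEPTH-ZERO VANISHING ROW `89a1`, `(p, d_K) = (5, -91)` — NO bit.** For `E = 89a1` (rank one), ANY
imaginary quadratic `K` with `d_K = -91` (Heegner for `N_E`), any frame `(Dt, β, ι)` and ANY
Kolyvagin–Heegner datum `d` of conductor `1`, granted (γ) = `GrossLMS1991.prop37_2_frobeniusCongruence`: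
`d.kolyvaginClass _ 1 = 0` in `H¹(K, E[5])` — the class of `y_K` vanishes mod `5`, because the twist
`E^{(-91)}` has two independent rational points (`two_le_rank_twist_neg91`, kernel) and a non-zero
depth-`0` class would force `1 ≥ rank_ℤ E^{(d_K)}(ℚ)` (minimal-depth descent, proved in the tree);
side conditions from `…RowsSecondSign8`. CONDITIONAL on (γ); per-curve; BSD is not proved by it.
[cite: Kolyvagin1991MathAnn, Thm. 2.3 and Thm. 4] [cite: GrossLMS1991, Prop. 3.7 (2), §4 (P_1 = y_K), §10] -/
theorem depthRowZero_5_neg91_vanishes_secondSign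
    (h372 : GrossLMS1991.prop37_2_frobeniusCongruence)
    (K : Type) [Field K] [NumberField K] (hK : IsImaginaryQuadratic K)
    (hD : NumberField.discr K = -91) :
    haveI := isElliptic;
    haveI := isGloballyMinimal;
    haveI : NeZero (((⟨1, 1, 1, -1, 0⟩ : WeierstrassCurve ℤ).map (Int.castRingHom ℚ)).conductorNorm ℤ) := neZero_conductorNorm_of_isElliptic _;
    ∀ (Dt : ModularParametrizationData ((⟨1, 1, 1, -1, 0⟩ : WeierstrassCurve ℤ).map (Int.castRingHom ℚ)) (((⟨1, 1, 1, -1, 0⟩ : WeierstrassCurve ℤ).map (Int.castRingHom ℚ)).conductorNorm ℤ)) (β : ℤ) (ι : K →+* ℂ)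
      (d : KolyvaginHeegnerData Dt β ι 1),
    d.kolyvaginClass (p := 5) (by norm_num) 1 = 0 := by
  haveI := isElliptic
  haveI := isGloballyMinimal
  haveI : NeZero (((⟨1, 1, 1, -1, 0⟩ : WeierstrassCurve ℤ).map (Int.castRingHom ℚ)).conductorNorm ℤ) := neZero_conductorNorm_of_isElliptic _
  intro Dt β ι d
  haveI := Fact.mk (by norm_num : Nat.Prime 5)
  exact depthRowZeroTwist_vanishes_printKN_of_intModel_certificate intModel h372 not_hasCM 5
    (by norm_num) hasSurjectiveModNGaloisRep_pow_5 K hK hD (by norm_num) (by norm_num)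
    twistModel_neg91 two_le_rank_twist_neg91 heegner_neg91 (Δ₀ := -89) (by decide +kernel)
    (B := 11) (by decide +kernel) (by decide +kernel) (fun _ _ ↦ Or.inl (by norm_num)) Dt β ι d

end C89a1

namespace C101a1

/-- **DEPTH-ZERO VANISHING ROW `101a1`, `(p, d_K) = (5, -179)` — NO bit.** For `E = 101a1` (rank one), ANY
imaginary quadratic `K` with `d_K = -179` (Heegner for `N_E`), any frame `(Dt, β, ι)` and ANY
Kolyvagin–Heegner datum `d` of conductor `1`, granted (γ) = `GrossLMS1991.prop37_2_frobeniusCongruence`: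
`d.kolyvaginClass _ 1 = 0` in `H¹(K, E[5])` — the class of `y_K` vanishes mod `5`, because the twist
`E^{(-179)}` has two independent rational points (`two_le_rank_twist_neg179`, kernel) and a non-zero
depth-`0` class would force `1 ≥ rank_ℤ E^{(d_K)}(ℚ)` (minimal-depth descent, proved in the tree);
side conditions from `…RowsSecondSign9`. CONDITIONAL on (γ); per-curve; BSD is not proved by it.
[cite: Kolyvagin1991MathAnn, Thm. 2.3 and Thm. 4] [cite: GrossLMS1991, Prop. 3.7 (2), §4 (P_1 = y_K), §10] -/
theorem depthRowZero_5_neg179_vanishes_secondSign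
    (h372 : GrossLMS1991.prop37_2_frobeniusCongruence)
    (K : Type) [Field K] [NumberField K] (hK : IsImaginaryQuadratic K)
    (hD : NumberField.discr K = -179) :
    haveI := isElliptic;
    haveI := isGloballyMinimal;
    haveI : NeZero (((⟨0, 1, 1, -1, -1⟩ : WeierstrassCurve ℤ).map (Int.castRingHom ℚ)).conductorNorm ℤ) := neZero_conductorNorm_of_isElliptic _;
    ∀ (Dt : ModularParametrizationData ((⟨0, 1, 1, -1, -1⟩ : WeierstrassCurve ℤ).map (Int.castRingHom ℚ)) (((⟨0, 1, 1, -1, -1⟩ : WeierstrassCurve ℤ).map (Int.castRingHom ℚ)).conductorNorm ℤ)) (β : ℤ) (ι : K →+* ℂ)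
      (d : KolyvaginHeegnerData Dt β ι 1),
    d.kolyvaginClass (p := 5) (by norm_num) 1 = 0 := by
  haveI := isElliptic
  haveI := isGloballyMinimal
  haveI : NeZero (((⟨0, 1, 1, -1, -1⟩ : WeierstrassCurve ℤ).map (Int.castRingHom ℚ)).conductorNorm ℤ) := neZero_conductorNorm_of_isElliptic _
  intro Dt β ι d
  haveI := Fact.mk (by norm_num : Nat.Prime 5)
  exact depthRowZeroTwist_vanishes_printKN_of_intModel_certificate intModel h372 not_hasCM 5
    (by norm_num) hasSurjectiveModNGaloisRep_pow_5 K hK hD (by norm_num) (by norm_num)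
    twistModel_neg179 two_le_rank_twist_neg179 heegner_neg179 (Δ₀ := 101) (by decide +kernel)
    (B := 11) (by decide +kernel) (by decide +kernel) (fun _ _ ↦ Or.inl (by norm_num)) Dt β ι d

end C101a1

namespace C131a1

/-- **DEPTH-ZERO VANISHING ROW `131a1`, `(p, d_K) = (5, -71)` — NO bit.** For `E = 131a1` (rank one), ANY
imaginary quadratic `K` with `d_K = -71` (Heegner for `N_E`), any frame `(Dt, β, ι)` and ANY
Kolyvagin–Heegner datum `d` of conductor `1`, granted (γ) = `GrossLMS1991.prop37_2_frobeniusCongruence`: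
`d.kolyvaginClass _ 1 = 0` in `H¹(K, E[5])` — the class of `y_K` vanishes mod `5`, because the twist
`E^{(-71)}` has two independent rational points (`two_le_rank_twist_neg71`, kernel) and a non-zero
depth-`0` class would force `1 ≥ rank_ℤ E^{(d_K)}(ℚ)` (minimal-depth descent, proved in the tree);
side conditions from `…RowsSecondSign10`. CONDITIONAL on (γ); per-curve; BSD is not proved by it.
[cite: Kolyvagin1991MathAnn, Thm. 2.3 and Thm. 4] [cite: GrossLMS1991, Prop. 3.7 (2), §4 (P_1 = y_K), §10] -/
theorem depthRowZero_5_neg71_vanishes_secondSign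
    (h372 : GrossLMS1991.prop37_2_frobeniusCongruence)
    (K : Type) [Field K] [NumberField K] (hK : IsImaginaryQuadratic K)
    (hD : NumberField.discr K = -71) :
    haveI := isElliptic;
    haveI := isGloballyMinimal;
    haveI : NeZero (((⟨0, -1, 1, 1, 0⟩ : WeierstrassCurve ℤ).map (Int.castRingHom ℚ)).conductorNorm ℤ) := neZero_conductorNorm_of_isElliptic _;
    ∀ (Dt : ModularParametrizationData ((⟨0, -1, 1, 1, 0⟩ : WeierstrassCurve ℤ).map (Int.castRingHom ℚ)) (((⟨0, -1, 1, 1, 0⟩ : WeierstrassCurve ℤ).map (Int.castRingHom ℚ)).conductorNorm ℤ)) (β : ℤ) (ι : K →+* ℂ)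
      (d : KolyvaginHeegnerData Dt β ι 1),
    d.kolyvaginClass (p := 5) (by norm_num) 1 = 0 := by
  haveI := isElliptic
  haveI := isGloballyMinimal
  haveI : NeZero (((⟨0, -1, 1, 1, 0⟩ : WeierstrassCurve ℤ).map (Int.castRingHom ℚ)).conductorNorm ℤ) := neZero_conductorNorm_of_isElliptic _
  intro Dt β ι d
  haveI := Fact.mk (by norm_num : Nat.Prime 5)
  exact depthRowZeroTwist_vanishes_printKN_of_intModel_certificate intModel h372 not_hasCM 5
    (by norm_num) hasSurjectiveModNGaloisRep_pow_5 K hK hD (by norm_num) (by norm_num)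
    twistModel_neg71 two_le_rank_twist_neg71 heegner_neg71 (Δ₀ := -131) (by decide +kernel)
    (B := 11) (by decide +kernel) (by decide +kernel) (fun _ _ ↦ Or.inl (by norm_num)) Dt β ι d

/-- **DEPTH-ZERO VANISHING ROW `131a1`, `(p, d_K) = (7, -155)` — NO bit.** For `E = 131a1` (rank one), ANY
imaginary quadratic `K` with `d_K = -155` (Heegner for `N_E`), any frame `(Dt, β, ι)` and ANY
Kolyvagin–Heegner datum `d` of conductor `1`, granted (γ) = `GrossLMS1991.prop37_2_frobeniusCongruence`:
`d.kolyvaginClass _ 1 = 0` in `H¹(K, E[7])` — the class of `y_K` vanishes mod `7`, because the twist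
`E^{(-155)}` has two independent rational points (`two_le_rank_twist_neg155`, kernel) and a non-zero
depth-`0` class would force `1 ≥ rank_ℤ E^{(d_K)}(ℚ)` (minimal-depth descent, proved in the tree);
side conditions from `…RowsSecondSign10`. CONDITIONAL on (γ); per-curve; BSD is not proved by it.
[cite: Kolyvagin1991MathAnn, Thm. 2.3 and Thm. 4] [cite: GrossLMS1991, Prop. 3.7 (2), §4 (P_1 = y_K), §10] -/
theorem depthRowZero_7_neg155_vanishes_secondSign
    (h372 : GrossLMS1991.prop37_2_frobeniusCongruence)
    (K : Type) [Field K] [NumberField K] (hK : IsImaginaryQuadratic K)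
    (hD : NumberField.discr K = -155) :
    haveI := isElliptic;
    haveI := isGloballyMinimal;
    haveI : NeZero (((⟨0, -1, 1, 1, 0⟩ : WeierstrassCurve ℤ).map (Int.castRingHom ℚ)).conductorNorm ℤ) := neZero_conductorNorm_of_isElliptic _;
    ∀ (Dt : ModularParametrizationData ((⟨0, -1, 1, 1, 0⟩ : WeierstrassCurve ℤ).map (Int.castRingHom ℚ)) (((⟨0, -1, 1, 1, 0⟩ : WeierstrassCurve ℤ).map (Int.castRingHom ℚ)).conductorNorm ℤ)) (β : ℤ) (ι : K →+* ℂ)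
      (d : KolyvaginHeegnerData Dt β ι 1),
    d.kolyvaginClass (p := 7) (by norm_num) 1 = 0 := by
  haveI := isElliptic
  haveI := isGloballyMinimal
  haveI : NeZero (((⟨0, -1, 1, 1, 0⟩ : WeierstrassCurve ℤ).map (Int.castRingHom ℚ)).conductorNorm ℤ) := neZero_conductorNorm_of_isElliptic _
  intro Dt β ι d
  haveI := Fact.mk (by norm_num : Nat.Prime 7)
  exact depthRowZeroTwist_vanishes_printKN_of_intModel_certificate intModel h372 not_hasCM 7
    (by norm_num) hasSurjectiveModNGaloisRep_pow_7 K hK hD (by norm_num) (by norm_num)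
    twistModel_neg155 two_le_rank_twist_neg155 heegner_neg155 (Δ₀ := -131) (by decide +kernel)
    (B := 11) (by decide +kernel) (by decide +kernel) (fun _ _ ↦ Or.inl (by norm_num)) Dt β ι d

end C131a1

end SecondSign

end Summit.BirchSwinnertonDyer.BirchSwinnertonDyer.Theorems.KolyvaginDepthDoor

end
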